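import Mathlib.Combinatorics.Pigeonhole
import Literature.Probability.RandomPlanarGeometry.CurveTortuosity
import HarnessLib

/-!
# Slit necklace, step D4: sub-shell pigeonhole for separate traversals

Crux `SAWLeftRightFKG.FKGToTraversalBound` (stmt-CriticalPhenomena-1878), line `slit-necklace`,
registered helper stub `hasTraversals_subshell_pigeonhole` of `stub_slitNecklace` (necklace chart,
step D4).

Deterministic geometry of curves.  Let `γ` be a curve in a pseudo-metric space, `D(x; ρ, R)` a
shell with `0 ≤ ρ`, `R - ρ ≥ 5 s`, `s > 0`, and let `c₀, …, c_{N-1}` be centres such that every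
point of the closed `R`-ball about `x` is within `s / 2` of some `cᵢ`.  If `D(x; ρ, R)` is
traversed by `N k` separate segments of `γ`, then one of the modulus-`2` shells `D(cᵢ; s, 2 s)` is
traversed by `k` separate segments of `γ`.  (The engine of the line only speaks about shells of
modulus `2`; this is the conversion.)

* One segment (`subshellPigeonhole_refine`): on a traversal `γ|[a, b]` of `D(x; ρ, R)` the
  continuous function `u ↦ dist (γ u) x` passes through the value `(ρ + R) / 2` at some time
  `θ ∈ [a, b]` (intermediate value theorem on `unitInterval`); the point `γ θ` lies in the closed
  `R`-ball, hence within `s / 2` of some centre `cᵢ`, and the endpoint of the segment outside the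
  open `R`-ball is at distance `≥ (R - ρ) / 2 - s / 2 ≥ 2 s` from `cᵢ` (triangle inequality).  So
  `[θ, b]` or `[a, θ]` is a traversal of `D(cᵢ; s, 2 s)` inside `[a, b]`.
* Pigeonhole: index the `N k` refined segments by their centres; some centre receives `≥ k` of
  them (`Fintype.exists_le_card_fiber_of_mul_le_card`; `N ≠ 0` because the centre `x` of the ball
  is covered), enumerated increasingly by `Finset.orderEmbOfFin`; sub-intervals of separated
  parameter intervals are separated.

Only theorems; axioms are the standard three.
-/

noncomputable section

open Set Metric
open Literature.Probability.RandomPlanarGeometry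

namespace Summit.CriticalPhenomena.SAWScalingLimit.Theorems.FKGToTraversalBound.SlitNecklace

/-- **One segment.**  A traversal `γ|[a, b]` of the shell `D(x; ρ, R)` (`R - ρ ≥ 5 s > 0`) contains
a traversal `γ|[a', b']`, `a ≤ a'`, `b' ≤ b`, of the modulus-`2` shell `D(cᵢ; s, 2 s)` about one of
the centres of any `s / 2`-net `c` of the closed `R`-ball about `x`: cut the segment at a time
where `dist (γ ·) x = (ρ + R) / 2` (intermediate value theorem) and keep the part ending outside
the open `R`-ball about `x`. [folklore] -/
private theorem subshellPigeonhole_refine {E : Type*} [PseudoMetricSpace E] (γ : Curve E) (x : E)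
    {ρ R s : ℝ} {N : ℕ} (c : Fin N → E) (hs : 0 < s) (hsR : 5 * s ≤ R - ρ)
    (hcov : ∀ m : E, dist m x ≤ R → ∃ i : Fin N, dist m (c i) ≤ s / 2) {a b : unitInterval}
    (h : γ.IsTraversal x ρ R a b) :
    ∃ i : Fin N, ∃ a' b' : unitInterval, a ≤ a' ∧ b' ≤ b ∧ γ.IsTraversal (c i) s (2 * s) a' b' := by
  have hgc : Continuous fun u : unitInterval ↦ dist (γ u) x := γ.continuous.dist continuous_const
  -- the endpoint outside the open `R`-ball is far from any centre close to a point at mid-distance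
  have hfar : ∀ (θ e : unitInterval) (i : Fin N), dist (γ θ) x = (ρ + R) / 2 →
      dist (γ θ) (c i) ≤ s / 2 → R ≤ dist (γ e) x → 2 * s ≤ dist (γ e) (c i) := by
    intro θ e i hθ hθi he
    have h1 := dist_triangle (γ e) (c i) x
    have h2 := dist_triangle (c i) (γ θ) x
    have h3 := dist_comm (c i) (γ θ)
    linarith
  rcases h.2 with ⟨ha, hb⟩ | ⟨ha, hb⟩
  · -- `γ a` is close to `x`, `γ b` is far: cut and keep `[θ, b]`
    obtain ⟨θ, hθ, hgθ⟩ := intermediate_value_Icc (f := fun u : unitInterval ↦ dist (γ u) x) h.1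
      hgc.continuousOn ⟨(by linarith : dist (γ a) x ≤ (ρ + R) / 2), (by linarith : (ρ + R) / 2 ≤ dist (γ b) x)⟩
    have hgθ' : dist (γ θ) x = (ρ + R) / 2 := hgθ
    obtain ⟨i, hi⟩ := hcov (γ θ) (by linarith)
    exact ⟨i, θ, b, hθ.1, le_rfl, hθ.2, Or.inl ⟨by linarith, hfar θ b i hgθ' hi hb⟩⟩
  · -- `γ a` is far from `x`, `γ b` is close: cut and keep `[a, θ]`
    obtain ⟨θ, hθ, hgθ⟩ := intermediate_value_Icc' (f := fun u : unitInterval ↦ dist (γ u) x) h.1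
      hgc.continuousOn ⟨(by linarith : dist (γ b) x ≤ (ρ + R) / 2), (by linarith : (ρ + R) / 2 ≤ dist (γ a) x)⟩
    have hgθ' : dist (γ θ) x = (ρ + R) / 2 := hgθ
    obtain ⟨i, hi⟩ := hcov (γ θ) (by linarith)
    exact ⟨i, a, θ, le_rfl, hθ.2, hθ.1, Or.inr ⟨hfar θ a i hgθ' hi ha, by linarith⟩⟩

/-- **Registered helper stub `hasTraversals_subshell_pigeonhole`** (crux stmt-CriticalPhenomena-1878,
line `slit-necklace`, necklace chart step D4): **sub-shell pigeonhole for separate traversals.**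
If every point of the closed `R`-ball about `x` is within `s / 2` of one of the `N` centres `cᵢ`,
`0 ≤ ρ`, `0 < s`, `5 s ≤ R - ρ`, and the shell `D(x; ρ, R)` is traversed by `N k` separate
segments of the curve `γ`, then one of the modulus-`2` shells `D(cᵢ; s, 2 s)` is traversed by `k`
separate segments of `γ` (each segment is cut at mid-distance `(ρ + R) / 2` from `x` and assigned
to a centre within `s / 2` of the cut point; pigeonhole on the centres). [folklore] -/
theorem hasTraversals_subshell_pigeonhole : ∀ {E : Type*} [PseudoMetricSpace E] (γ : Curve E)
    (x : E) (ρ R s : ℝ) {N k : ℕ} (c : Fin N → E), 0 ≤ ρ → 0 < s → 5 * s ≤ R - ρ →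
    (∀ m : E, dist m x ≤ R → ∃ i : Fin N, dist m (c i) ≤ s / 2) →
    γ.HasTraversals (N * k) x ρ R → ∃ i : Fin N, γ.HasTraversals k (c i) s (2 * s) := by
  intro E _ γ x ρ R s N k c hρ hs hsR hcov htrav
  -- `N ≠ 0`: the centre `x` of the ball is covered
  obtain ⟨i₀, -⟩ := hcov x (by rw [dist_self]; linarith)
  haveI : Nonempty (Fin N) := ⟨i₀⟩
  obtain ⟨p, q, hpq, hsep⟩ := htrav
  -- refine every segment to a traversal of a modulus-`2` sub-shell about some centre `c (idx m)`
  choose idx a b ha hb hab using fun m ↦ subshellPigeonhole_refine γ x c hs hsR hcov (hpq m)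
  -- pigeonhole on the centres
  obtain ⟨y, hy⟩ := Fintype.exists_le_card_fiber_of_mul_le_card (f := idx) (n := k)
    (by simp only [Fintype.card_fin, le_refl])
  obtain ⟨F, hF, hcard⟩ := Finset.exists_subset_card_eq hy
  have hidx : ∀ j : Fin k, idx (F.orderEmbOfFin hcard j) = y := fun j ↦ by
    simpa using hF (F.orderEmbOfFin_mem hcard j)
  refine ⟨y, fun j ↦ a (F.orderEmbOfFin hcard j), fun j ↦ b (F.orderEmbOfFin hcard j),
    fun j ↦ ?_, fun j j' hjj' ↦ ?_⟩
  · have := hab (F.orderEmbOfFin hcard j)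
    rwa [hidx j] at this
  · calc b (F.orderEmbOfFin hcard j) ≤ q (F.orderEmbOfFin hcard j) := hb _
      _ < p (F.orderEmbOfFin hcard j') := hsep ((F.orderEmbOfFin hcard).strictMono hjj')
      _ ≤ a (F.orderEmbOfFin hcard j') := ha _

end Summit.CriticalPhenomena.SAWScalingLimit.Theorems.FKGToTraversalBound.SlitNecklace

end
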